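import Literature.MathematicalPhysics.QuantumFieldTheory.Balaban1983to89.Node00.Record13CarriersSepCoPH

/-!
# NODE 00 (YM-PLAN Track A) — THE GENERIC **S-CLASS** OF THE v1.7 `SepCoPH` RECORD, `IsRecordOfRecord₁₃CSepCoPHS`: node00-def-T's record predicate `IsRecordOfRecord₁₃CSepCoPH` (FILE 28T)
# VERBATIM with ONE token changed, `upOfRecord₅C ↦ upOfRecord₅CS` (node00-def `Node00/CarriersB8.lean` :288 — the C-binding of record with its `b8` block re-bound in the SURVIVING Thm 8 form
# `B8LeafRS`; every other leaf untouched, `rfl`) — the tree twin plan g69 PROBE-K1V4-HOST (pub-ymgap INBOX l.19452) WANTED for the K1 rung 1 `NodesAtSomeRecord13PWS` (its `RecordS F θ h w` is THIS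
# body at the presenting pair; registered rung v4 and its rev-24 image inline it), typed at the v1.7 key by the ₁₃ carriers' declarer of record (seat `pub-ymgap-dag-n10-d` g11; dag-lead WORDS-130 ∕
# TABLE v46; count-neutral): the class, its pointed form and inhabitation, its CONSEQUENCES (provisos ∕ construction ∕ window ∕ the same-constants C-COMPANION ∕ the guarded (0.20) leaf ∕
# END FROM NODES), HOSTING at the S-binding over ANY re-bound ∕ [B13]-pinned ∕ X-pinned view and over the FOUR-PIN VIEW of any re-bound parameter, and the N12 `rBasicStep` face there

NODE 00 RECORD MODULE at Stage 13, v1.7 vocabulary.  plan g69's K1 rung 1 v3.1∕v4 (`K1Skeleton13SepCoPRv4.lean` 02cbd13c2df4f6a9; rev-24 image by T₇, plan g71 IMPACT-183) binds its world to the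
**S-BOUND** record class «`RecordS F θ h w` := def-T's `IsRecordOfRecord₁₃CSepCoP(R)(H)` AT THE PRESENTING PAIR `(θ, h)` with `upOfRecord₅C ↦ upOfRecord₅CS`» — SKELETON-LOCAL, spelled INLINE by
every rung-1 slice in the tree (dag-n24-c 8R `N24_recordS₁₃SepCoPR_of_upS_rebindX_view` ∕ `N24_nodesAtSomeRecordS₁₃SepCoPR_of_…`, dag-n08-c `…N08AtRecord13SepCoPR` §2S, dag-n12-d `…N12AtRecord13SepCoPRS`, this
seat's `…N10AtRecord13SepCoPRSB13` ∕ `…SepCoPHSB13`; ref-H READ-236: «the inline spelling is byte-exact … a one-token tree twin would retire the inlining»); plan: «CoPR twin `IsRecordOfRecord₁₃CSepCoPRS`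
WANTED as tree decls (+ `construction_eq_ ∕ gamma_pos_ ∕ rgFlow_of_smallCouplings_ ∕ endStatementBPrinted_of_…_of_nodes ∕ exists_world_`) … any pen, any file — tell me the module».  THIS LEAF types
the twin ONCE, at the LIVE key of the day after the v1.7 press (the ⁶ twin is not typed: K1⁶ goes aside at rev 24, director-ym №183 (5)), as the GENERIC class `IsRecordOfRecord₁₃CSepCoPHS F N D w :=
∃ (θ : Stage13HParams F N) (h : θ.Provisos₁₃SepCoPH F N), θ.Admissible ∧ D = datumOfRecord₁₃SepCoPH θ h ∧ w.C = D.C ∧ (0 < w.γ ∧ w.γ ≤ θ.γ) ∧ w.L = θ.L ∧ ∀ P, w.up P = upOfRecord₅CS ((θ.toStage5₁₃CoPH)) P`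
— plan's probe `v4pre_S_probe.lean` (8c20b74c86ee17d1, ⁵ key, probe-local `…S'`) under T₆∘T₇, with `RecordS F θ h w ↔ IsRecordOfRecord₁₃CSepCoPHS F N (datumOfRecord₁₃SepCoPH F N θ h) w` holding by
`Iff.rfl` (`recordS₁₃SepCoPH_iff`: the inline text IS the class's unfolding at θ's datum — every rung slice in the tree is a member statement verbatim).  §1 the class, `isRecordOfRecord₁₃CSepCoPHS_of_eq`,
`exists_world_isRecordOfRecord₁₃CSepCoPHS`, `recordS₁₃SepCoPH_iff`; §2 CONSEQUENCES: `exists_provisos_of_…`, `construction_eq_of_…`, `gamma_pos_of_…`, `companionC_of_…` (the same-constants world re-bound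
to the C-binding IS a def-T `IsRecordOfRecord₁₃CSepCoPH` record — the S-class reads the C-class's whole consequence family through it), `rgFlow_of_smallCouplings_of_…` (the guarded (0.20) leaf
reads `w.C`, `w.γ` only), `endStatementBPrinted_of_isRecordOfRecord₁₃CSepCoPHS_of_nodes` (END from «nodes at every run + β bounds in the window» at ANY S-class world — node00-def's
`endStatementBPrinted_of_nodesP_interval_guarded`); §3 HOSTING (this seat's carrier pins `Record13CarriersCoPH` §0–§1 ∕ `Record13CarriersSepCoPH`): `isRecordOfRecord₁₃CSepCoPHS_rebindX_of_eq ∕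
_pinB10_of_eq ∕ _pinB13_of_eq ∕ _pinX3_of_eq ∕ _pinX3H_of_eq` (world S-bound over the view of a re-bound ∕ pinned parameter, at θ's OWN datum), `exists_worldS_isRecordOfRecord₁₃CSepCoPHS_rebindX`,
★ `isRecordOfRecord₁₃CSepCoPHS_of_upS_rebindX_view₁₃CoPHB10YZW` (world S-bound over the FOUR-PIN VIEW of `θ.rebindX X'` — dag-n24-c's engine's world, `X'` FREE so that `XPinned₁₃H(S)` instantiates
— presenting parameter the quintuply pinned one; provisos `rebindX∕pinB10∕pinY∕pinZ∕pinW`, admissibility `Iff.rfl` ×5, datum `rfl` ×5, binding `view₁₃CoPHB10YZW_eq`),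
`exists_worldS_isRecordOfRecord₁₃CSepCoPHS_rebindX_view`; §4 the N12 pin face at that world `rBasicStep_iff_of_upS_rebindX_view₁₃CoPHB10YZW` (`withB8` does not touch `rBasicStep`).  APPEND-ONLY:
a NEW importing leaf; nothing landed is edited; no consumer is asked to re-key (the inline spellings stand and are `recordS₁₃SepCoPH_iff`-equivalent).
[Balaban1988Convergent] = Commun. Math. Phys. **119** (1988) 243–285; [Balaban1989LargeFieldII] = Commun. Math. Phys. **122** (1989) 355–392; [Balaban1985RegularSpaces] = Commun. Math.
Phys. **98** (1985) 17–51 (II: **99** (1985) 75–102); [Balaban1987RG1] = Commun. Math. Phys. **109** (1987) 249–301.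

HONEST FRAMING: one definition (a record predicate = def-T's with one binding token changed) + kernel bookkeeping (anonymous-constructor records, `rfl`, structure updates, three
citations of landed generic lemmas); NO estimate; nothing of Bałaban's asserted; no proviso inhabited; no node discharged; K1 not claimed; counts unmoved (typed 28∕28 · discharged 5∕27); a
re-key is not progress; one finite T⁴ programme at fixed ε = L^{−K} — NOT continuum ∕ ℝ⁴ ∕ OS ∕ mass gap ∕ Clay.  No `sorry`, no `axiom`, no `instance`, no `notation`.
-/

noncomputable section

namespace Literature.MathematicalPhysics.QuantumFieldTheory.Balaban1983to89.Node00

open T4Continuum AveragingRT T4FiniteEpsInhabited FlowStep FlowStepRuns DagBinding T4DatumAssembly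
open scoped Matrix.Norms.L2Operator

variable (F : T4Family) (N : ℕ) [NeZero N]

/-! ## §1. The S-class of the v1.7 record -/

section SClass

/-- **«(D, w) is the record, Stage 13, v1.7, S-BOUND»** — node00-def-T's `IsRecordOfRecord₁₃CSepCoPH` VERBATIM with the world bound to the S-BINDING of record `upOfRecord₅CS` (the C-binding with
its `b8` block re-bound in the surviving Thm 8 form `B8LeafRS`) over the v1.7 Stage-13 view: admissible v1.7 parameters SATISFYING the v1.7 separated-range provisos whose datum of record IS `D`,
construction `w.C = D.C`, window `0 < w.γ ≤ θ.γ`, Bałaban's block size.  = plan's skeleton-local `RecordS F θ h w` read at `D := datumOfRecord₁₃SepCoPH θ h` (`recordS₁₃SepCoPH_iff`).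
[cite: Balaban1989LargeFieldII, Thm 1 + (0.1) pp.355–356; Balaban1988Convergent, (0.2) p.244, (2.17)–(2.18) p.257, Thms 1–2 pp.262–263; Balaban1985RegularSpaces, Thm 8 p.101 (the surviving `b8`; objects of record, bookkeeping)] -/
def IsRecordOfRecord₁₃CSepCoPHS (D : FiniteEpsData F (SU N)) (w : WorldP) : Prop :=
  ∃ (θ : Stage13HParams F N) (h : θ.Provisos₁₃SepCoPH F N), θ.Admissible F N ∧ D = datumOfRecord₁₃SepCoPH F N θ h ∧ w.C = D.C ∧ (0 < w.γ ∧ w.γ ≤ θ.γ) ∧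
    w.L = (θ.L : ℝ) ∧ ∀ P : B12.RunParams, w.up P = upOfRecord₅CS F N (θ.toStage5₁₃CoPH F N) P

/-- **Pointed form** (presenting parameter `θ` itself). [cite: Balaban1989LargeFieldII, Thm 1 + (0.1) pp.355–356 (bookkeeping)] -/
theorem isRecordOfRecord₁₃CSepCoPHS_of_eq (θ : Stage13HParams F N) (h : θ.Provisos₁₃SepCoPH F N) (hθ : θ.Admissible F N) (w : WorldP)
    (hC : w.C = (datumOfRecord₁₃SepCoPH F N θ h).C) (hγ : 0 < w.γ ∧ w.γ ≤ θ.γ) (hL : w.L = (θ.L : ℝ))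
    (hup : ∀ P, w.up P = upOfRecord₅CS F N (θ.toStage5₁₃CoPH F N) P) :
    IsRecordOfRecord₁₃CSepCoPHS F N (datumOfRecord₁₃SepCoPH F N θ h) w :=
  ⟨θ, h, hθ, rfl, hC, hγ, hL, hup⟩

/-- **Every admissible v1.7 parameter with the v1.7 provisos presents an S-class record of its own datum**, any window `0 < γw ≤ θ.γ`. [cite: Balaban1989LargeFieldII, Thm 1 + (0.1) pp.355–356 (bookkeeping)] -/
theorem exists_world_isRecordOfRecord₁₃CSepCoPHS (θ : Stage13HParams F N) (h : θ.Provisos₁₃SepCoPH F N) (hθ : θ.Admissible F N) {γw : ℝ} (hγw : 0 < γw ∧ γw ≤ θ.γ) :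
    ∃ w : WorldP, IsRecordOfRecord₁₃CSepCoPHS F N (datumOfRecord₁₃SepCoPH F N θ h) w ∧ w.γ = γw ∧ w.L = (θ.L : ℝ) ∧
      ∀ P, w.up P = upOfRecord₅CS F N (θ.toStage5₁₃CoPH F N) P := by
  obtain ⟨w₀⟩ := nonempty_worldP
  exact ⟨{ w₀ with
      C := (datumOfRecord₁₃SepCoPH F N θ h).C, γ := γw, L := (θ.L : ℝ), one_lt_L := by exact_mod_cast θ.hL.2,
      up := fun P => upOfRecord₅CS F N (θ.toStage5₁₃CoPH F N) P },
    ⟨θ, h, hθ, rfl, rfl, hγw, rfl, fun _ => rfl⟩, rfl, rfl, fun _ => rfl⟩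

/-- **plan's skeleton-local `RecordS F θ h w` (the rung-1 slices' INLINE text, datum equation oriented `datumOfRecord₁₃SepCoPH θ h = datumOfRecord₁₃SepCoPH θ' h'`) IS membership in the S-class at
`datumOfRecord₁₃SepCoPH θ h`** — the inline text IS the class's unfolding at `D := datumOfRecord₁₃SepCoPH θ h` (`Iff.rfl`): a slice ports by `(recordS₁₃SepCoPH_iff …).1 ∕ .2` or `Iff.rfl`. [cite: Balaban1989LargeFieldII, Thm 1 + (0.1) pp.355–356 (bookkeeping)] -/
theorem recordS₁₃SepCoPH_iff (θ : Stage13HParams F N) (h : θ.Provisos₁₃SepCoPH F N) (w : WorldP) :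
    (∃ (θ' : Stage13HParams F N) (h' : θ'.Provisos₁₃SepCoPH F N), θ'.Admissible F N ∧
        datumOfRecord₁₃SepCoPH F N θ h = datumOfRecord₁₃SepCoPH F N θ' h' ∧ w.C = (datumOfRecord₁₃SepCoPH F N θ h).C ∧ (0 < w.γ ∧ w.γ ≤ θ'.γ) ∧
        w.L = (θ'.L : ℝ) ∧ ∀ P : B12.RunParams, w.up P = upOfRecord₅CS F N (θ'.toStage5₁₃CoPH F N) P) ↔
      IsRecordOfRecord₁₃CSepCoPHS F N (datumOfRecord₁₃SepCoPH F N θ h) w :=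
  Iff.rfl

end SClass

/-! ## §2. CONSEQUENCES of an S-class record: provisos, construction, window, the same-constants C-COMPANION, the guarded (0.20) leaf, END FROM NODES -/

section Consequences

variable {F N}
variable {D : FiniteEpsData F (SU N)} {w : WorldP}

/-- An S-class record CERTIFIES its parameters' provisos, admissibility and datum. [cite: Balaban1989LargeFieldI, (0.3)–(0.4) p.176 (bookkeeping)] -/
theorem exists_provisos_of_isRecordOfRecord₁₃CSepCoPHS (h : IsRecordOfRecord₁₃CSepCoPHS F N D w) :
    ∃ (θ : Stage13HParams F N) (hP : θ.Provisos₁₃SepCoPH F N), θ.Admissible F N ∧ D = datumOfRecord₁₃SepCoPH F N θ hP := by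
  obtain ⟨θ, hP, hθ, hD, -⟩ := h
  exact ⟨θ, hP, hθ, hD⟩

/-- The world is bound to the datum's construction. [cite: Balaban1989LargeFieldII, Thm 1 + (0.1) pp.355–356 (bookkeeping)] -/
theorem construction_eq_of_isRecordOfRecord₁₃CSepCoPHS (h : IsRecordOfRecord₁₃CSepCoPHS F N D w) : w.C = D.C := by
  obtain ⟨θ, hP, -, -, hC, -⟩ := h
  exact hC

/-- The world's window is non-degenerate. [cite: Balaban1987RG1, (0.20) p.256 (bookkeeping)] -/
theorem gamma_pos_of_isRecordOfRecord₁₃CSepCoPHS (h : IsRecordOfRecord₁₃CSepCoPHS F N D w) : 0 < w.γ := by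
  obtain ⟨θ, hP, -, -, -, hγ, -⟩ := h
  exact hγ.1

/-- **THE SAME-CONSTANTS C-COMPANION**: re-binding the world's upstream blocks to the C-BINDING at the presenting parameter (every other constant of the world kept) gives a def-T
`IsRecordOfRecord₁₃CSepCoPH` record AT THE SAME DATUM — through which the S-class reads the C-class's whole consequence family (the world-level leaves read `w.C`, `w.γ`, `w.L`, `w.b`, `w.βup` only).
[cite: Balaban1989LargeFieldII, Thm 1 + (0.1) pp.355–356; Balaban1985RegularSpaces, Thm 8 p.101 (bookkeeping)] -/
theorem companionC_of_isRecordOfRecord₁₃CSepCoPHS (h : IsRecordOfRecord₁₃CSepCoPHS F N D w) :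
    ∃ w' : WorldP, IsRecordOfRecord₁₃CSepCoPH F N D w' ∧ w'.C = w.C ∧ w'.γ = w.γ ∧ w'.L = w.L ∧ w'.b = w.b ∧ w'.βup = w.βup := by
  obtain ⟨θ, hP, hθ, hD, hC, hγ, hL, hup⟩ := h
  exact ⟨{ w with up := fun P => upOfRecord₅C F N (θ.toStage5₁₃CoPH F N) P }, ⟨θ, hP, hθ, hD, hC, hγ, hL, fun _ => rfl⟩, rfl, rfl, rfl, rfl, rfl⟩

/-- **GUARDED (0.20) AT EVERY S-CLASS RECORD**: the leaf reads `w.C`, `w.γ` only — def-T's C-class instance at the C-companion, verbatim. [cite: Balaban1987RG1, (0.20) p.256] -/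
theorem rgFlow_of_smallCouplings_of_isRecordOfRecord₁₃CSepCoPHS (h : IsRecordOfRecord₁₃CSepCoPHS F N D w) (P : B12.RunParams)
    (hsc : (leavesP w P).smallCouplings) : (leavesP w P).rgFlow := by
  obtain ⟨θ, hP, hθ, hD, hC, hγ, hL, hup⟩ := h
  have hR' : IsRecordOfRecord₁₃CSepCoPH F N D { w with up := fun P => upOfRecord₅C F N (θ.toStage5₁₃CoPH F N) P } :=
    ⟨θ, hP, hθ, hD, hC, hγ, hL, fun _ => rfl⟩
  exact rgFlow_of_smallCouplings_of_isRecordOfRecord₁₃CSepCoPH hR' P hsc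

/-- **END FROM NODES AT ANY S-CLASS RECORD**: the DAG's nodes at every run and the β bounds in a window `γ₀ ≥ w.γ` give print's END STATEMENT for `D.C` (node00-def's
`endStatementBPrinted_of_nodesP_interval_guarded` with the guarded (0.20) leaf above; the v3.1∕v4 rung 2 ∕ K1 junction at an S-bound world).
[cite: Balaban1989LargeFieldII, Thm 1 + (0.1) pp.355–356; Balaban1987RG1, (0.20) p.256; Balaban1988Convergent, Thms 1–2 pp.262–263 (bookkeeping)] -/
theorem endStatementBPrinted_of_isRecordOfRecord₁₃CSepCoPHS_of_nodes (h : IsRecordOfRecord₁₃CSepCoPHS F N D w) {γ₀ : ℝ} (hγ₀ : w.γ ≤ γ₀)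
    (hnodes : ∀ P, Nodes (leavesP w P)) (hβ : BetaBoundsInInterval w.C.toB12 γ₀ w.b w.βup) :
    B16.EndStatementBPrinted D.C := by
  rw [← construction_eq_of_isRecordOfRecord₁₃CSepCoPHS h]
  exact endStatementBPrinted_of_nodesP_interval_guarded w (gamma_pos_of_isRecordOfRecord₁₃CSepCoPHS h) hγ₀ hnodes
    (rgFlow_of_smallCouplings_of_isRecordOfRecord₁₃CSepCoPHS h) hβ

end Consequences

/-! ## §3. HOSTING: worlds S-bound over re-bound ∕ pinned views and over the four-pin view of a re-bound parameter are in the S-class AT θ's OWN DATUM -/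

section Hosting

/-- **A world S-bound over the Stage-13 view of the RE-BOUND parameter `θ.rebindX X'` is an S-class record at θ's own datum** (presenting parameter `θ.rebindX X'`; provisos
`Provisos₁₃SepCoPH.rebindX`, admissibility `Iff.rfl`, datum UP-SIDE `datumOfRecord₁₃SepCoPH_rebindX`). [cite: Balaban1989LargeFieldII, Thm 1 + (0.1) pp.355–356 (bookkeeping)] -/
theorem isRecordOfRecord₁₃CSepCoPHS_rebindX_of_eq (θ : Stage13HParams F N) (h : θ.Provisos₁₃SepCoPH F N) (hθ : θ.Admissible F N) (X' : B12.RunParams → PrintedCarriersR)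
    (w : WorldP) (hC : w.C = (datumOfRecord₁₃SepCoPH F N θ h).C) (hγ : 0 < w.γ ∧ w.γ ≤ θ.γ) (hL : w.L = (θ.L : ℝ))
    (hup : ∀ P, w.up P = upOfRecord₅CS F N ((θ.rebindX F N X').toStage5₁₃CoPH F N) P) :
    IsRecordOfRecord₁₃CSepCoPHS F N (datumOfRecord₁₃SepCoPH F N θ h) w :=
  ⟨θ.rebindX F N X', h.rebindX X', (Stage13HParams.rebindX_admissible_iff F N θ X').2 hθ, (datumOfRecord₁₃SepCoPH_rebindX F N θ h X' (h.rebindX X')).symm,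
    hC, hγ, hL, hup⟩

/-- The [B10] instance. [cite: Balaban1989LargeFieldII, Thm 1 + (0.1) pp.355–356; Balaban1985UV3, Thm 1 p.257 (bookkeeping)] -/
theorem isRecordOfRecord₁₃CSepCoPHS_pinB10_of_eq (θ : Stage13HParams F N) (h : θ.Provisos₁₃SepCoPH F N) (hθ : θ.Admissible F N)
    (w : WorldP) (hC : w.C = (datumOfRecord₁₃SepCoPH F N θ h).C) (hγ : 0 < w.γ ∧ w.γ ≤ θ.γ) (hL : w.L = (θ.L : ℝ))
    (hup : ∀ P, w.up P = upOfRecord₅CS F N ((θ.pinB10 F N).toStage5₁₃CoPH F N) P) :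
    IsRecordOfRecord₁₃CSepCoPHS F N (datumOfRecord₁₃SepCoPH F N θ h) w :=
  isRecordOfRecord₁₃CSepCoPHS_rebindX_of_eq F N θ h hθ _ w hC hγ hL hup

/-- The [B13] instance (this seat's N10 S-slices `…N10AtRecord13SepCoPHSB13` §2 present exactly this). [cite: Balaban1989LargeFieldII, Thm 1 + (0.1) pp.355–356; Balaban1988RG2Cluster, Lemmas 1–3 pp.9–20 (bookkeeping)] -/
theorem isRecordOfRecord₁₃CSepCoPHS_pinB13_of_eq (θ : Stage13HParams F N) (h : θ.Provisos₁₃SepCoPH F N) (hθ : θ.Admissible F N)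
    (lam : B12.RunParams → ResidB13 θ.toStage3Params) (w : WorldP) (hC : w.C = (datumOfRecord₁₃SepCoPH F N θ h).C) (hγ : 0 < w.γ ∧ w.γ ≤ θ.γ) (hL : w.L = (θ.L : ℝ))
    (hup : ∀ P, w.up P = upOfRecord₅CS F N ((θ.pinB13 F N lam).toStage5₁₃CoPH F N) P) :
    IsRecordOfRecord₁₃CSepCoPHS F N (datumOfRecord₁₃SepCoPH F N θ h) w :=
  isRecordOfRecord₁₃CSepCoPHS_rebindX_of_eq F N θ h hθ _ w hC hγ hL hup

/-- The X-pinned instance. [cite: Balaban1989LargeFieldII, Thm 1 + (0.1) pp.355–356 (bookkeeping)] -/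
theorem isRecordOfRecord₁₃CSepCoPHS_pinX3_of_eq (θ : Stage13HParams F N) (h : θ.Provisos₁₃SepCoPH F N) (hθ : θ.Admissible F N) (lam8 : ResidB8 θ.toStage3Params)
    (lam12 : ResidB12 F N θ.τ9.M) (lam13 : B12.RunParams → ResidB13 θ.toStage3Params) (w : WorldP) (hC : w.C = (datumOfRecord₁₃SepCoPH F N θ h).C)
    (hγ : 0 < w.γ ∧ w.γ ≤ θ.γ) (hL : w.L = (θ.L : ℝ)) (hup : ∀ P, w.up P = upOfRecord₅CS F N ((θ.pinX3 F N lam8 lam12 lam13).toStage5₁₃CoPH F N) P) :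
    IsRecordOfRecord₁₃CSepCoPHS F N (datumOfRecord₁₃SepCoPH F N θ h) w :=
  isRecordOfRecord₁₃CSepCoPHS_rebindX_of_eq F N θ h hθ _ w hC hγ hL hup

/-- The REPAIRED X-pinned instance (dag-n05-d's `XPinned₁₃H`; their S-socket pin `XPinned₁₃HS` is likewise a `rebindX` and instantiates the generic form). [cite: Balaban1989LargeFieldII, Thm 1 + (0.1) pp.355–356 (bookkeeping)] -/
theorem isRecordOfRecord₁₃CSepCoPHS_pinX3H_of_eq (θ : Stage13HParams F N) (h : θ.Provisos₁₃SepCoPH F N) (hθ : θ.Admissible F N) (lam8 : ResidB8 θ.toStage3Params)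
    (lam12 : ResidB12 F N θ.τ9.M) (lam13 : B12.RunParams → ResidB13 θ.toStage3Params) (w : WorldP) (hC : w.C = (datumOfRecord₁₃SepCoPH F N θ h).C)
    (hγ : 0 < w.γ ∧ w.γ ≤ θ.γ) (hL : w.L = (θ.L : ℝ)) (hup : ∀ P, w.up P = upOfRecord₅CS F N ((θ.pinX3H F N lam8 lam12 lam13).toStage5₁₃CoPH F N) P) :
    IsRecordOfRecord₁₃CSepCoPHS F N (datumOfRecord₁₃SepCoPH F N θ h) w :=
  isRecordOfRecord₁₃CSepCoPHS_rebindX_of_eq F N θ h hθ _ w hC hγ hL hup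

/-- **… and such worlds EXIST**: every admissible v1.7 parameter with the v1.7 provisos presents an S-class record of its own datum over the S-binding of ANY re-bound Stage-13 view, any
window `0 < γw ≤ θ.γ`, block size `θ.L`. [cite: Balaban1989LargeFieldII, Thm 1 + (0.1) pp.355–356 (bookkeeping)] -/
theorem exists_worldS_isRecordOfRecord₁₃CSepCoPHS_rebindX (θ : Stage13HParams F N) (h : θ.Provisos₁₃SepCoPH F N) (hθ : θ.Admissible F N)
    (X' : B12.RunParams → PrintedCarriersR) {γw : ℝ} (hγw : 0 < γw ∧ γw ≤ θ.γ) :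
    ∃ w : WorldP, IsRecordOfRecord₁₃CSepCoPHS F N (datumOfRecord₁₃SepCoPH F N θ h) w ∧ w.γ = γw ∧ w.L = (θ.L : ℝ) ∧
      ∀ P, w.up P = upOfRecord₅CS F N ((θ.rebindX F N X').toStage5₁₃CoPH F N) P := by
  obtain ⟨w₀⟩ := nonempty_worldP
  exact ⟨{ w₀ with
      C := (datumOfRecord₁₃SepCoPH F N θ h).C, γ := γw, L := (θ.L : ℝ), one_lt_L := by exact_mod_cast θ.hL.2,
      up := fun P => upOfRecord₅CS F N ((θ.rebindX F N X').toStage5₁₃CoPH F N) P },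
    isRecordOfRecord₁₃CSepCoPHS_rebindX_of_eq F N θ h hθ X' _ rfl hγw rfl (fun _ => rfl), rfl, rfl, fun _ => rfl⟩

/-- ★ **HOSTING AT THE FOUR-PIN VIEW OF A RE-BOUND PARAMETER** (dag-n24-c's S-bound engine's world; `X'` FREE — at dag-n05-d's S-socket H-pin `X' := XPinned₁₃HS …` the [B8″H] slot reads the surviving
leaf): a world with `w.C = (datumOfRecord₁₃SepCoPH θ h).C`, `0 < w.γ ≤ θ.γ`, `w.L = θ.L`, `w.up P = upOfRecord₅CS ((θ.rebindX X').view₁₃CoPHB10YZW M⋆ ops ζ λW) P` IS in the S-class AT θ's DATUM —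
presenting parameter the quintuply pinned `((((θ.rebindX X').pinB10).pinY …).pinZ …).pinW …` (provisos by this seat's `Provisos₁₃SepCoPH.rebindX ∕ .pinB10 ∕ .pinY ∕ .pinZ ∕ .pinW`, admissibility `Iff.rfl` ×5,
datum `rfl` ×5 UP-SIDE, binding `view₁₃CoPHB10YZW_eq`); = plan's probe (b) under T₆∘T₇, = the named form of dag-n24-c's inline `N24_recordS₁₃SepCoP(R)_of_upS_rebindX_view`.
[cite: Balaban1989LargeFieldII, Thm 1 + (0.1) pp.355–356; Balaban1985UV3, Thm 1 p.257; Balaban1985BackgroundPropagators, Thm 3.1 p.397; Balaban1985Variational, Thm 1 p.279; Balaban1989LargeFieldI, (0.2) p.176 (objects of record; bookkeeping)] -/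
theorem isRecordOfRecord₁₃CSepCoPHS_of_upS_rebindX_view₁₃CoPHB10YZW (θ : Stage13HParams F N) (hP : θ.Provisos₁₃SepCoPH F N) (hθ : θ.Admissible F N)
    (X' : B12.RunParams → PrintedCarriersR) (Mstar : ℕ) (ops : OpsY N θ.toStage3Params Mstar) (ζ : ResidZ F N) (lamW : ResidW F N) (w : WorldP)
    (hC : w.C = (datumOfRecord₁₃SepCoPH F N θ hP).C) (hγ : 0 < w.γ ∧ w.γ ≤ θ.γ) (hL : w.L = (θ.L : ℝ))
    (hup : ∀ P, w.up P = upOfRecord₅CS F N ((θ.rebindX F N X').view₁₃CoPHB10YZW F N Mstar ops ζ lamW) P) :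
    IsRecordOfRecord₁₃CSepCoPHS F N (datumOfRecord₁₃SepCoPH F N θ hP) w := by
  have hX : (θ.rebindX F N X').Provisos₁₃SepCoPH F N := hP.rebindX X'
  have hD := datumOfRecord₁₃SepCoPH_rebindX F N θ hP X' hX
  rw [← hD] at hC ⊢
  set θX := θ.rebindX F N X' with hθX
  have hθ' : θX.Admissible F N := (Stage13HParams.rebindX_admissible_iff F N θ X').2 hθ
  have hA1 : (θX.pinB10 F N).Admissible F N := (Stage13Params.pinB10_admissible_iff F N θX.toStage13Params).2 hθ'
  have hA2 : ((θX.pinB10 F N).pinY F N (Y9OfRecord N θX.toStage3Params Mstar ops)).Admissible F N :=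
    (Stage13Params.pinY_admissible_iff F N (θX.pinB10 F N).toStage13Params (Y9OfRecord N θX.toStage3Params Mstar ops)).2 hA1
  have hA3 : (((θX.pinB10 F N).pinY F N (Y9OfRecord N θX.toStage3Params Mstar ops)).pinZ F N (Z11OfRecord F N ζ)).Admissible F N :=
    (Stage13Params.pinZ_admissible_iff F N ((θX.pinB10 F N).pinY F N (Y9OfRecord N θX.toStage3Params Mstar ops)).toStage13Params (Z11OfRecord F N ζ)).2 hA2
  have hA4 : ((((θX.pinB10 F N).pinY F N (Y9OfRecord N θX.toStage3Params Mstar ops)).pinZ F N (Z11OfRecord F N ζ)).pinW F N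
      (WOfRecord₁₃ F N θX.toStage13Params lamW)).Admissible F N :=
    (Stage13Params.pinW_admissible_iff F N (((θX.pinB10 F N).pinY F N (Y9OfRecord N θX.toStage3Params Mstar ops)).pinZ F N (Z11OfRecord F N ζ)).toStage13Params
      (WOfRecord₁₃ F N θX.toStage13Params lamW)).2 hA3
  refine ⟨(((θX.pinB10 F N).pinY F N (Y9OfRecord N θX.toStage3Params Mstar ops)).pinZ F N (Z11OfRecord F N ζ)).pinW F N (WOfRecord₁₃ F N θX.toStage13Params lamW),
    ((hX.pinB10.pinY (Y9OfRecord N θX.toStage3Params Mstar ops)).pinZ (Z11OfRecord F N ζ)).pinW (WOfRecord₁₃ F N θX.toStage13Params lamW), hA4, ?_, hC, hγ, hL, fun P => ?_⟩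
  · exact ((datumOfRecord₁₃SepCoPH_pinB10 F N θX hX).symm.trans
      ((datumOfRecord₁₃SepCoPH_pinY F N (θX.pinB10 F N) hX.pinB10 (Y9OfRecord N θX.toStage3Params Mstar ops)).symm.trans
        ((datumOfRecord₁₃SepCoPH_pinZ F N _ (hX.pinB10.pinY (Y9OfRecord N θX.toStage3Params Mstar ops)) (Z11OfRecord F N ζ)).symm.trans
          (datumOfRecord₁₃SepCoPH_pinW F N _ ((hX.pinB10.pinY (Y9OfRecord N θX.toStage3Params Mstar ops)).pinZ (Z11OfRecord F N ζ))
            (WOfRecord₁₃ F N θX.toStage13Params lamW)).symm)))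
  · rw [hup P, Stage13HParams.view₁₃CoPHB10YZW_eq]

/-- **… and such worlds EXIST** at every admissible v1.7 parameter with the v1.7 provisos, any pins, any window `0 < γw ≤ θ.γ`. [cite: Balaban1989LargeFieldII, Thm 1 + (0.1) pp.355–356 (bookkeeping)] -/
theorem exists_worldS_isRecordOfRecord₁₃CSepCoPHS_rebindX_view (θ : Stage13HParams F N) (hP : θ.Provisos₁₃SepCoPH F N) (hθ : θ.Admissible F N)
    (X' : B12.RunParams → PrintedCarriersR) (Mstar : ℕ) (ops : OpsY N θ.toStage3Params Mstar) (ζ : ResidZ F N) (lamW : ResidW F N) {γw : ℝ} (hγw : 0 < γw ∧ γw ≤ θ.γ) :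
    ∃ w : WorldP, IsRecordOfRecord₁₃CSepCoPHS F N (datumOfRecord₁₃SepCoPH F N θ hP) w ∧ w.γ = γw ∧ w.L = (θ.L : ℝ) ∧
      ∀ P, w.up P = upOfRecord₅CS F N ((θ.rebindX F N X').view₁₃CoPHB10YZW F N Mstar ops ζ lamW) P := by
  obtain ⟨w₀⟩ := nonempty_worldP
  let w : WorldP :=
    { w₀ with
      C := (datumOfRecord₁₃SepCoPH F N θ hP).C, γ := γw, L := (θ.L : ℝ), one_lt_L := by exact_mod_cast θ.hL.2,
      up := fun P => upOfRecord₅CS F N ((θ.rebindX F N X').view₁₃CoPHB10YZW F N Mstar ops ζ lamW) P }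
  exact ⟨w, isRecordOfRecord₁₃CSepCoPHS_of_upS_rebindX_view₁₃CoPHB10YZW F N θ hP hθ X' Mstar ops ζ lamW w rfl hγw rfl (fun _ => rfl), rfl, rfl, fun _ => rfl⟩

end Hosting

/-! ## §4. The N12 pin face at a world S-bound over the four-pin view of a re-bound parameter -/

section PinFaces

variable {F N}

/-- **On every run the `rBasicStep` leaf the DAG reads IS `B15Leaf` at NODE 00's bundle of record `WOfRecord₁₃ θ λW P`** (`withB8` does not touch `rBasicStep`; this seat's
`upOfRecord₅C_view₁₃CoPHB10YZW_leaves` (first conjunct); the re-bound parameter's bundle is θ's, `rfl`) — the rung's N12 pin conjunct at that world. [cite: Balaban1989LargeFieldI, Prop. 1 p.194, (0.2) p.176 (bookkeeping)] -/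
theorem rBasicStep_iff_of_upS_rebindX_view₁₃CoPHB10YZW (θ : Stage13HParams F N) (X' : B12.RunParams → PrintedCarriersR) (Mstar : ℕ)
    (ops : OpsY N θ.toStage3Params Mstar) (ζ : ResidZ F N) (lamW : ResidW F N) (w : WorldP)
    (hup : ∀ P, w.up P = upOfRecord₅CS F N ((θ.rebindX F N X').view₁₃CoPHB10YZW F N Mstar ops ζ lamW) P) (P : B12.RunParams) :
    (leavesP w P).rBasicStep ↔ B15Leaf (WOfRecord₁₃ F N θ.toStage13Params lamW P) := by
  have hW : WOfRecord₁₃ F N (θ.rebindX F N X').toStage13Params lamW = WOfRecord₁₃ F N θ.toStage13Params lamW := rfl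
  rw [← hW]
  show (w.up P).rBasicStep ↔ _
  rw [hup P]
  exact (upOfRecord₅C_view₁₃CoPHB10YZW_leaves F N (θ.rebindX F N X') Mstar ops ζ lamW P).1

end PinFaces

end Literature.MathematicalPhysics.QuantumFieldTheory.Balaban1983to89.Node00

end
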